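import Summits.Ventures.QEC.Thresholds.RotatedSurfaceCodeSAWThresholds
import Summits.Ventures.QEC.Thresholds.RotatedSurfaceCodeSAWThresholdsZ
import Summits.Ventures.QEC.Thresholds.PlanarSurfaceCodePhenomSAWBox
import Literature.InformationTheory.QuantumCodes.RotatedSurfaceCodeDrawing
import Literature.InformationTheory.QuantumCodes.RotatedSurfaceCodeDrawingZ
import Literature.InformationTheory.QuantumCodes.CSSPhenomenologicalDepolarizing
import HarnessLib
-- buildfix (bf3-g30) G30-27: comment-only touch to re-dispatch the lane build (dead-lettered rc 76 (att 7, last 20:24 08-27 / 06:01 08-28) behind Literature.InformationTheory.QuantumCodes.ToricCodeErasureHalfGeometry whose hub olean is fresh; root and file farm rc 0 now (lane datum: host-local stale dependency olean); no build event for 9-19 h); declarations byte-identical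

/-!
# Rotated surface codes with TWO noise rates (qubit faults `p`, measurement faults `q`): the certified threshold BOX
# `p, q < p₀(4.7476)`, in particular every `0 ≤ p, q < .0112`, both sectors, every minimum-weight space-time decoder family —
# unconditional, tier CERTIFIED (kernel)

Venture QEC, `Summits/Ventures/QEC/Thresholds/` (LADDER-QEC rung Q5, PARTITION row 09 "phenomenological"; qec-type-09 gen 7, cell
item «09.RSCPH» = PARTITION v2.48 D50.L6, box form). `RotatedSurfaceCodePhenomSAWThresholds(Z).lean` treat the diagonal `q = p`
(this file does not import them: it needs only their one-line odd-residual lemmas, restated privately, so that it depends on built modules only).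
Dennis–Kitaev–Landahl–Preskill state the noisy-measurement threshold as a BOX ("p, q < .0114", eq. (threshold_iso_num)): the
relative space-time polygon bound holds with `p̃` replaced by the larger of the two rates. The Literature files of this item
already carry the two-rate counting bounds `rsc_st_sum_oddResidual_le_twoRate` / `rsc_stZ_sum_oddResidual_le_twoRate`
(`≤ L·T·C·r^L/(1-r)`, `r = 2ν√(ρ(1-ρ))`, `p, q ≤ ρ`) and their limits; this file packages the consequences for the census
two-rate families `zPhenomFailureFamily₂ rscCode T D` / `xPhenomFailureFamily₂ rscCode T D` (`PhenomenologicalBoxThresholds.lean`):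

| theorem | statement | tier |
|---|---|---|
| `rsc_z_phenom_belowThreshold₂_of_sawCountBound3`, `rsc_x_phenom_belowThreshold₂_of_sawCountBound3` | `cₙ(ℤ³) ≤ C νⁿ`, `0 ≤ p, q ≤ ρ ≤ 1/2`, `4ν² ρ(1-ρ) < 1` ⇒ `P_fail(p, q) → 0` (each sector, every poly schedule, every minimum-weight space-time decoder family) | CERTIFIED (kernel), parametric |
| `rsc_z_phenom_isThresholdBoxLowerBound_of_connectiveConstant_three_le`, `rsc_x_…` | `μ(ℤ³) ≤ μ' ⇒` the box `[0, p₀(μ'))²` is below threshold | CERTIFIED (kernel), parametric |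
| ★ `rsc_z_phenom_isThresholdBoxLowerBound_kernelZ3SymmK12`, ★ `rsc_x_phenom_isThresholdBoxLowerBound_kernelZ3SymmK12`, `…_0112`, `…_mwpm_…` | **the box `p, q < p₀(4.7476)` (⊇ `[0, .0112)²`)** for both sectors of `RSC(L)`, every `L`, every minimum-weight space-time decoder family, in particular space-time boundary-MWPM | CERTIFIED (kernel), unconditional |
| `rsc_dklp_bothRecords_belowThreshold₂_0112` | for ALL `0 ≤ p, q < .0112` BOTH records of the rotated memory experiment have `P_fail → 0` | CERTIFIED (kernel), unconditional |
| `rsc_depolPhenom_belowThreshold_of_lt`, ★ `rsc_depolPhenom_belowThreshold_0168_0112` | PHENOMENOLOGICAL DEPOLARIZING noise (qubits depolarized at rate `p` per round, `X`- and `Z`-check records wrong at rates `q_X`, `q_Z`), sector-wise minimum-weight space-time decoding: `2p/3, q_X, q_Z < p₀(4.7476)` — in particular **`p < .0168`, `q_X, q_Z < .0112`** — ⇒ `P_fail → 0` (lit-2's sandwich `CSSCode.depolPhenom_belowThreshold_iff`) | CERTIFIED (kernel), unconditional |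

HONEST FRAMING. Certified LOWER bounds on the threshold region, one error type at a time; decimals from the kernel certificate
`μ(ℤ³) ≤ 4.7476`; DKLP's printed box `.0114` and all numerical / circuit-level values remain CLAIMS. No `native_decide`, no named fact.

## References

* [DennisEtAl2002] E. Dennis, A. Kitaev, A. Landahl, J. Preskill, *Topological quantum memory*, J. Math. Phys. 43 (2002)
  4452–4505, arXiv:quant-ph/0110143, §4.2 (rates p on horizontal, q on vertical links), §5.3 eq. (threshold_iso_num) ("p, q <
  .0114"), §4.1 (both error types).
* [PonitzTittmann2000] Electron. J. Combin. 7 (2000) R21, Table 2 (`d = 3, k = 12`).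
* [AliferisGottesmanPreskill2006] P. Aliferis, D. Gottesman, J. Preskill, arXiv:quant-ph/0504218, §8.2 (depolarizing noise,
  X and Z errors corrected separately).
-/

noncomputable section

namespace Summit.Ventures.QEC.Thresholds

open Filter Topology Finset Matrix
open Literature.InformationTheory.QuantumCodes
open Literature.InformationTheory.QuantumCodes.RotatedSurface
open Literature.InformationTheory.QuantumCodes.ToricCode (SAWCountBound3 IsPolyBounded)
open Literature.Probability.RandomPlanarGeometry

/-! ### The two-rate bounds below `4ν² ρ(1-ρ) < 1` -/

/-- The rates of the two-rate model are in `[0, 1]` when `0 ≤ p, q ≤ ρ ≤ 1/2`. [cite: DennisEtAl2002, §4.2 (rates p, q)] -/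
private theorem phenomRate_bounds' {Qb Ck : Type*} {T : ℕ} {p q ρ : ℝ} (hp0 : 0 ≤ p) (hq0 : 0 ≤ q) (hpρ : p ≤ ρ)
    (hqρ : q ≤ ρ) (hρ : ρ ≤ 1 / 2) (ℓ : HistoryLoc Qb Ck T) : 0 ≤ phenomRate p q ℓ ∧ phenomRate p q ℓ ≤ 1 := by
  rcases ℓ with ℓ | ℓ <;> simp [phenomRate] <;> constructor <;> linarith

/-- (Private copy of `rsc_phenom_oddResidual_of_not_corrects` of `RotatedSurfaceCodePhenomSAWThresholds.lean`, restated here so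
that this file imports only built modules.) Failure of the `H_X`-sector memory experiment ⇒ the projected residual has an odd
number of column-`0` qubits. [cite: DennisEtAl2002, §4.3 (success iff the residual is homologically trivial) and §6.1 (Π)] -/
private theorem oddResidual_of_not_corrects_X {L : ℕ} (hL : 0 < L) (T : ℕ)
    {D : CSSPhenom.STDecoder (Fin (L + 1) × Fin (L - 1)) (Fin L × Fin L) T}
    (hD : D.IsMinWeight (CSSPhenom.stSyn (HX L) T) (CSSPhenom.stCycles (HX L) T) hammingNorm)
    {E : CSSPhenom.History (Fin (L + 1) × Fin (L - 1)) (Fin L × Fin L) T}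
    (hfail : ¬ D.Corrects (CSSPhenom.stSyn (HX L) T)
      (CSSPhenom.stTrivial ((RotatedSurface.code L).rowSpZ : Set (Fin L × Fin L → ZMod 2)) T) E) :
    ∑ i : Fin L, CSSPhenom.proj (D (CSSPhenom.stSyn (HX L) T E) + E) (i, ⟨0, hL⟩) = 1 :=
  rsc_colZero_eq_one hL (CSSPhenom.mulVec_proj_eq_zero (hD.add_mem E)) hfail

/-- (Private copy of `rsc_phenomZ_oddResidual_of_not_corrects` of `RotatedSurfaceCodePhenomSAWThresholdsZ.lean`.) Failure of the
`H_Z`-sector memory experiment ⇒ the projected residual has an odd number of row-`0` qubits.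
[cite: DennisEtAl2002, §4.3 (success iff the residual is homologically trivial) and §6.1 (Π)] -/
private theorem oddResidual_of_not_corrects_Z {L : ℕ} (hL : 0 < L) (T : ℕ)
    {D : CSSPhenom.STDecoder (Fin (L - 1) × Fin (L + 1)) (Fin L × Fin L) T}
    (hD : D.IsMinWeight (CSSPhenom.stSyn (HZ L) T) (CSSPhenom.stCycles (HZ L) T) hammingNorm)
    {E : CSSPhenom.History (Fin (L - 1) × Fin (L + 1)) (Fin L × Fin L) T}
    (hfail : ¬ D.Corrects (CSSPhenom.stSyn (HZ L) T)
      (CSSPhenom.stTrivial ((RotatedSurface.code L).rowSpX : Set (Fin L × Fin L → ZMod 2)) T) E) :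
    ∑ j : Fin L, CSSPhenom.proj (D (CSSPhenom.stSyn (HZ L) T E) + E) (⟨0, hL⟩, j) = 1 :=
  rsc_rowZero_eq_one hL (CSSPhenom.mulVec_proj_eq_zero (hD.add_mem E)) hfail

open Classical in
/-- The two-rate failure probability of the `H_X`-sector memory experiment of `RSC(i+1)` is at most the two-rate probability of
an odd column-`0` projected residual. [cite: DennisEtAl2002, §5.2 (Prob_fail ≤ the probability of a non-trivial relative space-time polygon)] -/
theorem rsc_phenom_failure₂_le_sum_oddResidual (T : ℕ → ℕ)
    (D : ∀ i, CSSPhenom.STDecoder (Fin (i + 1 + 1) × Fin (i + 1 - 1)) (Fin (i + 1) × Fin (i + 1)) (T i))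
    (hD : ∀ i, (D i).IsMinWeight (CSSPhenom.stSyn (rscCode i).HX (T i)) (CSSPhenom.stCycles (rscCode i).HX (T i))
      hammingNorm) (i : ℕ) {p q ρ : ℝ} (hp0 : 0 ≤ p) (hq0 : 0 ≤ q) (hpρ : p ≤ ρ) (hqρ : q ≤ ρ) (hρ : ρ ≤ 1 / 2) :
    zPhenomFailureFamily₂ rscCode T D i p q ≤
      ∑ E ∈ univ.filter (fun E : CSSPhenom.History (Fin (i + 1 + 1) × Fin (i + 1 - 1)) (Fin (i + 1) × Fin (i + 1)) (T i) =>
        ∑ j : Fin (i + 1), CSSPhenom.proj (D i (CSSPhenom.stSyn (HX (i + 1)) (T i) E) + E) (j, ⟨0, by omega⟩) = 1),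
        phenomenologicalWeight (T i) p q (supp E) := by
  refine Finset.sum_le_sum_of_subset_of_nonneg (fun E hE => ?_) fun E _ _ => ?_
  · rw [Finset.mem_filter] at hE ⊢
    exact ⟨Finset.mem_univ _, oddResidual_of_not_corrects_X (by omega) (T i) (hD i) hE.2⟩
  · exact indepWeight_nonneg (fun ℓ => (phenomRate_bounds' hp0 hq0 hpρ hqρ hρ ℓ).1)
      (fun ℓ => (phenomRate_bounds' hp0 hq0 hpρ hqρ hρ ℓ).2) _

open Classical in
/-- The same for the `H_Z` sector (odd row-`0` projected residual). [cite: DennisEtAl2002, §5.2 (Prob_fail ≤ the probability of a non-trivial relative space-time polygon)] -/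
theorem rsc_phenomZ_failure₂_le_sum_oddResidual (T : ℕ → ℕ)
    (D : ∀ i, CSSPhenom.STDecoder (Fin (i + 1 - 1) × Fin (i + 1 + 1)) (Fin (i + 1) × Fin (i + 1)) (T i))
    (hD : ∀ i, (D i).IsMinWeight (CSSPhenom.stSyn (rscCode i).HZ (T i)) (CSSPhenom.stCycles (rscCode i).HZ (T i))
      hammingNorm) (i : ℕ) {p q ρ : ℝ} (hp0 : 0 ≤ p) (hq0 : 0 ≤ q) (hpρ : p ≤ ρ) (hqρ : q ≤ ρ) (hρ : ρ ≤ 1 / 2) :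
    xPhenomFailureFamily₂ rscCode T D i p q ≤
      ∑ E ∈ univ.filter (fun E : CSSPhenom.History (Fin (i + 1 - 1) × Fin (i + 1 + 1)) (Fin (i + 1) × Fin (i + 1)) (T i) =>
        ∑ j : Fin (i + 1), CSSPhenom.proj (D i (CSSPhenom.stSyn (HZ (i + 1)) (T i) E) + E) (⟨0, by omega⟩, j) = 1),
        phenomenologicalWeight (T i) p q (supp E) := by
  refine Finset.sum_le_sum_of_subset_of_nonneg (fun E hE => ?_) fun E _ _ => ?_
  · rw [Finset.mem_filter] at hE ⊢
    exact ⟨Finset.mem_univ _, oddResidual_of_not_corrects_Z (by omega) (T i) (hD i) hE.2⟩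
  · exact indepWeight_nonneg (fun ℓ => (phenomRate_bounds' hp0 hq0 hpρ hqρ hρ ℓ).1)
      (fun ℓ => (phenomRate_bounds' hp0 hq0 hpρ hqρ hρ ℓ).2) _

/-- **`H_X` sector: below threshold in the box `[0, ρ]²` when `4ν² ρ(1-ρ) < 1`** (given `cₙ(ℤ³) ≤ C νⁿ`, `ν > 0`, polynomially
many rounds, every minimum-weight space-time decoder family). [cite: DennisEtAl2002, §5.3 eq. (threshold_iso)] -/
theorem rsc_z_phenom_belowThreshold₂_of_sawCountBound3 {C ν : ℝ} (hν : 0 < ν) (hC : SAWCountBound3 C ν) {T : ℕ → ℕ}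
    (hT : IsPolyBounded T)
    (D : ∀ i, CSSPhenom.STDecoder (Fin (i + 1 + 1) × Fin (i + 1 - 1)) (Fin (i + 1) × Fin (i + 1)) (T i))
    (hD : ∀ i, (D i).IsMinWeight (CSSPhenom.stSyn (rscCode i).HX (T i)) (CSSPhenom.stCycles (rscCode i).HX (T i))
      hammingNorm)
    {p q ρ : ℝ} (hp0 : 0 ≤ p) (hq0 : 0 ≤ q) (hpρ : p ≤ ρ) (hqρ : q ≤ ρ) (hρ : ρ ≤ 1 / 2)
    (h4 : 4 * ν ^ 2 * (ρ * (1 - ρ)) < 1) : BelowThreshold₂ (zPhenomFailureFamily₂ rscCode T D) p q := by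
  have ht := rsc_st_tendsto_sum_oddResidual_twoRate hν hC hT D hD hp0 hq0 hpρ hqρ hρ h4
  refine squeeze_zero' (Filter.Eventually.of_forall fun i => ?_)
    (Filter.Eventually.of_forall fun i => rsc_phenom_failure₂_le_sum_oddResidual T D hD i hp0 hq0 hpρ hqρ hρ) ht
  refine Finset.sum_nonneg fun E _ => ?_
  exact indepWeight_nonneg (fun ℓ => (phenomRate_bounds' hp0 hq0 hpρ hqρ hρ ℓ).1)
    (fun ℓ => (phenomRate_bounds' hp0 hq0 hpρ hqρ hρ ℓ).2) _

/-- **`H_Z` sector: below threshold in the box `[0, ρ]²` when `4ν² ρ(1-ρ) < 1`** (same hypotheses).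
[cite: DennisEtAl2002, §5.3 eq. (threshold_iso)] -/
theorem rsc_x_phenom_belowThreshold₂_of_sawCountBound3 {C ν : ℝ} (hν : 0 < ν) (hC : SAWCountBound3 C ν) {T : ℕ → ℕ}
    (hT : IsPolyBounded T)
    (D : ∀ i, CSSPhenom.STDecoder (Fin (i + 1 - 1) × Fin (i + 1 + 1)) (Fin (i + 1) × Fin (i + 1)) (T i))
    (hD : ∀ i, (D i).IsMinWeight (CSSPhenom.stSyn (rscCode i).HZ (T i)) (CSSPhenom.stCycles (rscCode i).HZ (T i))
      hammingNorm)
    {p q ρ : ℝ} (hp0 : 0 ≤ p) (hq0 : 0 ≤ q) (hpρ : p ≤ ρ) (hqρ : q ≤ ρ) (hρ : ρ ≤ 1 / 2)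
    (h4 : 4 * ν ^ 2 * (ρ * (1 - ρ)) < 1) : BelowThreshold₂ (xPhenomFailureFamily₂ rscCode T D) p q := by
  have ht := rsc_stZ_tendsto_sum_oddResidual_twoRate hν hC hT D hD hp0 hq0 hpρ hqρ hρ h4
  refine squeeze_zero' (Filter.Eventually.of_forall fun i => ?_)
    (Filter.Eventually.of_forall fun i => rsc_phenomZ_failure₂_le_sum_oddResidual T D hD i hp0 hq0 hpρ hqρ hρ) ht
  refine Finset.sum_nonneg fun E _ => ?_
  exact indepWeight_nonneg (fun ℓ => (phenomRate_bounds' hp0 hq0 hpρ hqρ hρ ℓ).1)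
    (fun ℓ => (phenomRate_bounds' hp0 hq0 hpρ hqρ hρ ℓ).2) _

/-! ### From the connective constant to the box `[0, p₀(μ'))²`; the kernel certificate -/

/-- **`H_X` sector: the two-rate threshold box from any bound on `μ(ℤ³)`** (`μ(ℤ³) ≤ μ'`, `μ' ≥ 1`): every rate pair in
`[0, p₀(μ'))²` is below threshold. [cite: DennisEtAl2002, §5.3 eqs. (saw_3), (threshold_iso_num)] -/
theorem rsc_z_phenom_isThresholdBoxLowerBound_of_connectiveConstant_three_le {μ' : ℝ} (hμ'1 : 1 ≤ μ')
    (hμ : SAW.Zd.connectiveConstant 3 ≤ μ') {T : ℕ → ℕ} (hT : IsPolyBounded T)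
    (D : ∀ i, CSSPhenom.STDecoder (Fin (i + 1 + 1) × Fin (i + 1 - 1)) (Fin (i + 1) × Fin (i + 1)) (T i))
    (hD : ∀ i, (D i).IsMinWeight (CSSPhenom.stSyn (rscCode i).HX (T i)) (CSSPhenom.stCycles (rscCode i).HX (T i))
      hammingNorm) :
    IsThresholdBoxLowerBound (zPhenomFailureFamily₂ rscCode T D) (thresholdValue μ') := by
  refine IsThresholdBoxLowerBound.of_forall_le fun p q ρ hp0 hq0 hpρ hqρ hρ => ?_
  have hρ0 : 0 ≤ ρ := hp0.trans hpρ
  have hρh : ρ ≤ 1 / 2 := hρ.le.trans (thresholdValue_le_half μ')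
  obtain ⟨ν, hν, h4⟩ := exists_gt_four_mul_sq_lt_one_of_lt_thresholdValue hμ'1 hρ0 hρ
  obtain ⟨C, hC⟩ := exists_sawCountBound3_of_connectiveConstant_lt (lt_of_le_of_lt hμ hν)
  exact rsc_z_phenom_belowThreshold₂_of_sawCountBound3 (by linarith) hC hT D hD hp0 hq0 hpρ hqρ hρh h4

/-- **`H_Z` sector: the two-rate threshold box from any bound on `μ(ℤ³)`.** [cite: DennisEtAl2002, §5.3 eqs. (saw_3), (threshold_iso_num)] -/
theorem rsc_x_phenom_isThresholdBoxLowerBound_of_connectiveConstant_three_le {μ' : ℝ} (hμ'1 : 1 ≤ μ')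
    (hμ : SAW.Zd.connectiveConstant 3 ≤ μ') {T : ℕ → ℕ} (hT : IsPolyBounded T)
    (D : ∀ i, CSSPhenom.STDecoder (Fin (i + 1 - 1) × Fin (i + 1 + 1)) (Fin (i + 1) × Fin (i + 1)) (T i))
    (hD : ∀ i, (D i).IsMinWeight (CSSPhenom.stSyn (rscCode i).HZ (T i)) (CSSPhenom.stCycles (rscCode i).HZ (T i))
      hammingNorm) :
    IsThresholdBoxLowerBound (xPhenomFailureFamily₂ rscCode T D) (thresholdValue μ') := by
  refine IsThresholdBoxLowerBound.of_forall_le fun p q ρ hp0 hq0 hpρ hqρ hρ => ?_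
  have hρ0 : 0 ≤ ρ := hp0.trans hpρ
  have hρh : ρ ≤ 1 / 2 := hρ.le.trans (thresholdValue_le_half μ')
  obtain ⟨ν, hν, h4⟩ := exists_gt_four_mul_sq_lt_one_of_lt_thresholdValue hμ'1 hρ0 hρ
  obtain ⟨C, hC⟩ := exists_sawCountBound3_of_connectiveConstant_lt (lt_of_le_of_lt hμ hν)
  exact rsc_x_phenom_belowThreshold₂_of_sawCountBound3 (by linarith) hC hT D hD hp0 hq0 hpρ hqρ hρh h4

/-- ★ **`H_X` sector: the rotated two-rate threshold BOX `p, q < p₀(4.7476)`** (every polynomially bounded schedule, every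
minimum-weight space-time decoder family, every `L`) — UNCONDITIONAL, tier CERTIFIED (kernel), from `μ(ℤ³) ≤ 4.7476`.
[cite: DennisEtAl2002, §5.3 eq. (threshold_iso_num) (the box p, q)] [cite: PonitzTittmann2000, Table 2 (d = 3, k = 12)] -/
theorem rsc_z_phenom_isThresholdBoxLowerBound_kernelZ3SymmK12 {T : ℕ → ℕ} (hT : IsPolyBounded T)
    (D : ∀ i, CSSPhenom.STDecoder (Fin (i + 1 + 1) × Fin (i + 1 - 1)) (Fin (i + 1) × Fin (i + 1)) (T i))
    (hD : ∀ i, (D i).IsMinWeight (CSSPhenom.stSyn (rscCode i).HX (T i)) (CSSPhenom.stCycles (rscCode i).HX (T i))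
      hammingNorm) :
    IsThresholdBoxLowerBound (zPhenomFailureFamily₂ rscCode T D) (thresholdValue 4.7476) :=
  rsc_z_phenom_isThresholdBoxLowerBound_of_connectiveConstant_three_le (by norm_num)
    SAW.Zd.FiniteMemory3.connectiveConstant_three_le_47476 hT D hD

/-- ★ **`H_Z` sector: the rotated two-rate threshold BOX `p, q < p₀(4.7476)`** — UNCONDITIONAL, tier CERTIFIED (kernel).
[cite: DennisEtAl2002, §5.3 eq. (threshold_iso_num)] [cite: PonitzTittmann2000, Table 2 (d = 3, k = 12)] -/
theorem rsc_x_phenom_isThresholdBoxLowerBound_kernelZ3SymmK12 {T : ℕ → ℕ} (hT : IsPolyBounded T)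
    (D : ∀ i, CSSPhenom.STDecoder (Fin (i + 1 - 1) × Fin (i + 1 + 1)) (Fin (i + 1) × Fin (i + 1)) (T i))
    (hD : ∀ i, (D i).IsMinWeight (CSSPhenom.stSyn (rscCode i).HZ (T i)) (CSSPhenom.stCycles (rscCode i).HZ (T i))
      hammingNorm) :
    IsThresholdBoxLowerBound (xPhenomFailureFamily₂ rscCode T D) (thresholdValue 4.7476) :=
  rsc_x_phenom_isThresholdBoxLowerBound_of_connectiveConstant_three_le (by norm_num)
    SAW.Zd.FiniteMemory3.connectiveConstant_three_le_47476 hT D hD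

/-- Decimal box, `H_X` sector: **every rate pair `0 ≤ p, q < .0112` is below threshold** — UNCONDITIONAL, tier CERTIFIED (kernel).
[cite: DennisEtAl2002, §5.3 eq. (threshold_iso_num)] -/
theorem rsc_z_phenom_isThresholdBoxLowerBound_0112 {T : ℕ → ℕ} (hT : IsPolyBounded T)
    (D : ∀ i, CSSPhenom.STDecoder (Fin (i + 1 + 1) × Fin (i + 1 - 1)) (Fin (i + 1) × Fin (i + 1)) (T i))
    (hD : ∀ i, (D i).IsMinWeight (CSSPhenom.stSyn (rscCode i).HX (T i)) (CSSPhenom.stCycles (rscCode i).HX (T i))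
      hammingNorm) :
    IsThresholdBoxLowerBound (zPhenomFailureFamily₂ rscCode T D) 0.0112 :=
  (rsc_z_phenom_isThresholdBoxLowerBound_kernelZ3SymmK12 hT D hD).mono thresholdValue_47476_bounds.1.le

/-- Decimal box, `H_Z` sector: **every rate pair `0 ≤ p, q < .0112` is below threshold** — UNCONDITIONAL, tier CERTIFIED (kernel).
[cite: DennisEtAl2002, §5.3 eq. (threshold_iso_num)] -/
theorem rsc_x_phenom_isThresholdBoxLowerBound_0112 {T : ℕ → ℕ} (hT : IsPolyBounded T)
    (D : ∀ i, CSSPhenom.STDecoder (Fin (i + 1 - 1) × Fin (i + 1 + 1)) (Fin (i + 1) × Fin (i + 1)) (T i))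
    (hD : ∀ i, (D i).IsMinWeight (CSSPhenom.stSyn (rscCode i).HZ (T i)) (CSSPhenom.stCycles (rscCode i).HZ (T i))
      hammingNorm) :
    IsThresholdBoxLowerBound (xPhenomFailureFamily₂ rscCode T D) 0.0112 :=
  (rsc_x_phenom_isThresholdBoxLowerBound_kernelZ3SymmK12 hT D hD).mono thresholdValue_47476_bounds.1.le

/-- **Space-time boundary-MWPM, `H_X` sector**: the box `p, q < p₀(4.7476)` for every space-time boundary-MWPM family.
[cite: DennisEtAl2002, §5.1 (E_min by matching) and §5.3 eq. (threshold_iso_num)] -/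
theorem rsc_z_phenom_mwpm_isThresholdBoxLowerBound_kernelZ3SymmK12 {T : ℕ → ℕ} (hT : IsPolyBounded T)
    {ι : ∀ i, Fin (i + 1) × Fin (i + 1) → Sym2 (Option (Fin (i + 1 + 1) × Fin (i + 1 - 1)))}
    (hι : ∀ i, IsGraphlikeVia (rscCode i).HX (ι i)) (m : ∀ i, EdgeMetric (stEndsOf (ι i) (T i)))
    {D' : ∀ i, Decoder (Option ((Fin (i + 1 + 1) × Fin (i + 1 - 1)) × Fin (T i + 1)) → ZMod 2)
      (HistoryLoc (Fin (i + 1) × Fin (i + 1)) (Fin (i + 1 + 1) × Fin (i + 1 - 1)) (T i) → ZMod 2)}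
    (hD : ∀ i, IsMatchingDecoder (m i) (D' i)) :
    IsThresholdBoxLowerBound (zPhenomFailureFamily₂ rscCode T fun i => boundaryDecoder (D' i)) (thresholdValue 4.7476) :=
  rsc_z_phenom_isThresholdBoxLowerBound_kernelZ3SymmK12 hT _ fun i => isMinWeight_boundaryDecoder_st (hι i) (T i) (hD i)

/-- **Space-time boundary-MWPM, `H_Z` sector**: the box `p, q < p₀(4.7476)` for every space-time boundary-MWPM family.
[cite: DennisEtAl2002, §5.1 (E_min by matching) and §5.3 eq. (threshold_iso_num)] -/
theorem rsc_x_phenom_mwpm_isThresholdBoxLowerBound_kernelZ3SymmK12 {T : ℕ → ℕ} (hT : IsPolyBounded T)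
    {ι : ∀ i, Fin (i + 1) × Fin (i + 1) → Sym2 (Option (Fin (i + 1 - 1) × Fin (i + 1 + 1)))}
    (hι : ∀ i, IsGraphlikeVia (rscCode i).HZ (ι i)) (m : ∀ i, EdgeMetric (stEndsOf (ι i) (T i)))
    {D' : ∀ i, Decoder (Option ((Fin (i + 1 - 1) × Fin (i + 1 + 1)) × Fin (T i + 1)) → ZMod 2)
      (HistoryLoc (Fin (i + 1) × Fin (i + 1)) (Fin (i + 1 - 1) × Fin (i + 1 + 1)) (T i) → ZMod 2)}
    (hD : ∀ i, IsMatchingDecoder (m i) (D' i)) :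
    IsThresholdBoxLowerBound (xPhenomFailureFamily₂ rscCode T fun i => boundaryDecoder (D' i)) (thresholdValue 4.7476) :=
  rsc_x_phenom_isThresholdBoxLowerBound_kernelZ3SymmK12 hT _ fun i => isMinWeight_boundaryDecoder_st (hι i) (T i) (hD i)

/-- ★ **DKLP's box for the complete rotated memory experiment, certified at `.0112`**: for ALL `0 ≤ p, q < .0112`, every
polynomially bounded schedule and every pair of minimum-weight space-time decoder families (one per record), BOTH records of the
rotated surface codes (every size) have failure probability `→ 0` (the printed toric figure is "p, q < .0114", numerical).
UNCONDITIONAL, tier CERTIFIED (kernel). [cite: DennisEtAl2002, §5.3 eq. (threshold_iso_num) and §4.1 (both error types)] -/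
theorem rsc_dklp_bothRecords_belowThreshold₂_0112 {T : ℕ → ℕ} (hT : IsPolyBounded T)
    (DZ : ∀ i, CSSPhenom.STDecoder (Fin (i + 1 + 1) × Fin (i + 1 - 1)) (Fin (i + 1) × Fin (i + 1)) (T i))
    (hDZ : ∀ i, (DZ i).IsMinWeight (CSSPhenom.stSyn (rscCode i).HX (T i)) (CSSPhenom.stCycles (rscCode i).HX (T i))
      hammingNorm)
    (DX : ∀ i, CSSPhenom.STDecoder (Fin (i + 1 - 1) × Fin (i + 1 + 1)) (Fin (i + 1) × Fin (i + 1)) (T i))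
    (hDX : ∀ i, (DX i).IsMinWeight (CSSPhenom.stSyn (rscCode i).HZ (T i)) (CSSPhenom.stCycles (rscCode i).HZ (T i))
      hammingNorm)
    {p q : ℝ} (hp₀ : 0 ≤ p) (hq₀ : 0 ≤ q) (hp : p < 0.0112) (hq : q < 0.0112) :
    BelowThreshold₂ (zPhenomFailureFamily₂ rscCode T DZ) p q ∧ BelowThreshold₂ (xPhenomFailureFamily₂ rscCode T DX) p q :=
  ⟨rsc_z_phenom_isThresholdBoxLowerBound_0112 hT DZ hDZ p q hp₀ hq₀ hp hq,
    rsc_x_phenom_isThresholdBoxLowerBound_0112 hT DX hDX p q hp₀ hq₀ hp hq⟩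

/-! ### Phenomenological DEPOLARIZING noise (three rates), sector-wise minimum-weight space-time decoding -/

/-- **Rotated surface codes under phenomenological depolarizing noise**: for every polynomially bounded schedule `T`, every
pair of minimum-weight space-time decoders (`DZ` on the `X`-check record, `DX` on the `Z`-check record) and all rates with
`2p/3, q_X, q_Z < p₀(4.7476)`, `p ≤ 1`: the three-rate failure probability tends to `0` (the two sector boxes at `(2p/3, q_X)` and
`(2p/3, q_Z)` through lit-2's sandwich `max(P^Z, P^X) ≤ P_fail ≤ P^Z + P^X`). UNCONDITIONAL, tier CERTIFIED (kernel).
[cite: DennisEtAl2002, §4.1 (depolarizing channel; X and Z errors corrected separately) and §5.3 eq. (threshold_iso_num)] [cite: AliferisGottesmanPreskill2006, §8.2] -/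
theorem rsc_depolPhenom_belowThreshold_of_lt {T : ℕ → ℕ} (hT : IsPolyBounded T)
    (DZ : ∀ i, CSSPhenom.STDecoder (Fin (i + 1 + 1) × Fin (i + 1 - 1)) (Fin (i + 1) × Fin (i + 1)) (T i))
    (hDZ : ∀ i, (DZ i).IsMinWeight (CSSPhenom.stSyn (rscCode i).HX (T i)) (CSSPhenom.stCycles (rscCode i).HX (T i))
      hammingNorm)
    (DX : ∀ i, CSSPhenom.STDecoder (Fin (i + 1 - 1) × Fin (i + 1 + 1)) (Fin (i + 1) × Fin (i + 1)) (T i))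
    (hDX : ∀ i, (DX i).IsMinWeight (CSSPhenom.stSyn (rscCode i).HZ (T i)) (CSSPhenom.stCycles (rscCode i).HZ (T i))
      hammingNorm)
    {p qX qZ : ℝ} (hp0 : 0 ≤ p) (hp1 : p ≤ 1) (hp : 2 * p / 3 < thresholdValue 4.7476) (hqX0 : 0 ≤ qX)
    (hqX : qX < thresholdValue 4.7476) (hqZ0 : 0 ≤ qZ) (hqZ : qZ < thresholdValue 4.7476) :
    Tendsto (fun i => (rscCode i).depolPhenomFailureProb (T i) (DZ i) (DX i) p qX qZ) atTop (𝓝 0) := by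
  have hq0 : 0 ≤ 2 * p / 3 := by positivity
  have hhalf := thresholdValue_le_half (4.7476 : ℝ)
  have hZ := rsc_z_phenom_isThresholdBoxLowerBound_kernelZ3SymmK12 hT DZ hDZ (2 * p / 3) qX hq0 hqX0 hp hqX
  have hX := rsc_x_phenom_isThresholdBoxLowerBound_kernelZ3SymmK12 hT DX hDX (2 * p / 3) qZ hq0 hqZ0 hp hqZ
  exact (CSSCode.depolPhenom_belowThreshold_iff rscCode T DZ DX hp0 hp1 hqX0 (by linarith) hqZ0 (by linarith)).2
    ⟨hZ, hX⟩

/-- ★ **Decimal form: `p < .0168`, `q_X, q_Z < .0112` ⇒ `P_fail → 0`** for the rotated surface codes (every size) under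
phenomenological depolarizing noise, sector-wise minimum-weight space-time decoding, polynomially many rounds — UNCONDITIONAL,
tier CERTIFIED (kernel) (`2·(.0168)/3 = .0112 < p₀(4.7476)`). [cite: DennisEtAl2002, §4.1 and §5.3 eq. (threshold_iso_num)] [cite: AliferisGottesmanPreskill2006, §8.2] -/
theorem rsc_depolPhenom_belowThreshold_0168_0112 {T : ℕ → ℕ} (hT : IsPolyBounded T)
    (DZ : ∀ i, CSSPhenom.STDecoder (Fin (i + 1 + 1) × Fin (i + 1 - 1)) (Fin (i + 1) × Fin (i + 1)) (T i))
    (hDZ : ∀ i, (DZ i).IsMinWeight (CSSPhenom.stSyn (rscCode i).HX (T i)) (CSSPhenom.stCycles (rscCode i).HX (T i))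
      hammingNorm)
    (DX : ∀ i, CSSPhenom.STDecoder (Fin (i + 1 - 1) × Fin (i + 1 + 1)) (Fin (i + 1) × Fin (i + 1)) (T i))
    (hDX : ∀ i, (DX i).IsMinWeight (CSSPhenom.stSyn (rscCode i).HZ (T i)) (CSSPhenom.stCycles (rscCode i).HZ (T i))
      hammingNorm)
    {p qX qZ : ℝ} (hp0 : 0 ≤ p) (hp : p < 0.0168) (hqX0 : 0 ≤ qX) (hqX : qX < 0.0112) (hqZ0 : 0 ≤ qZ)
    (hqZ : qZ < 0.0112) :
    Tendsto (fun i => (rscCode i).depolPhenomFailureProb (T i) (DZ i) (DX i) p qX qZ) atTop (𝓝 0) := by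
  have h := thresholdValue_47476_bounds.1
  exact rsc_depolPhenom_belowThreshold_of_lt hT DZ hDZ DX hDX hp0 (by linarith) (by linarith) hqX0 (by linarith) hqZ0
    (by linarith)

end Summit.Ventures.QEC.Thresholds
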